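import Summits.NavierStokesRegularity.NavierStokesRegularity.Theses.PumpContinuation
import Literature.Analysis.FluidPDE.LocalTypeI
import Literature.Analysis.FluidPDE.TaoAveragedSobolevProofs

/-!
# Sketch (crux-ideate, ideator 1, round 1) — first lemmas of the idea cards for
# `BoundedTemperatureClosed` (stmt-NavierStokesRegularity-18303)

Statements only (`def … : Prop`), plus two sorry-free glue theorems showing how the pieces
compose.  Nothing here is proposed to the tree.

* Card `euler-share-uloc-endpoint`: `EulerShareNormalisation` (first lemma),
  `EndpointCompactness` (the compactness half, output = a bounded-datum local-Leray Type-I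
  Navier–Stokes singularity), `TypeIDecayStripping` (the isolated hard half), glue
  `atOne_of_compactness_of_stripping`, by-product `door_localTypeI`.
* Card `closed-relation-taming`: `ClosedRelation` (first lemma), `Taming` (hard half), glue
  `boundedTemperatureClosed_of_closedRelation_of_taming`, and the provable tame core `TameClosed`.
-/

noncomputable section

set_option linter.dupNamespace false

namespace Summit.NavierStokesRegularity.NavierStokesRegularity.Cruxes.BoundedTemperatureClosed.Ideator1

open MeasureTheory Set Filter Topology
open scoped ENNReal
open Literature.Analysis.FluidPDE Literature.Analysis.FluidPDE.Tao2016
open Summit.NavierStokesRegularity.NavierStokesRegularity.Theses.PumpContinuation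

local notation "ℝ³" => EuclideanSpace ℝ (Fin 3)

/-! ### The pieces of the crux, named (verbatim bodies) -/

/-- The segment of trilinear forms `T_θ = (1-θ)·B̃_𝒜 + θ·B`. -/
def segForm (𝒜 : AveragingDatum) (θ : ℝ) : L2C → L2C → L2C → ℂ :=
  fun a b c => ((1 - θ : ℝ) : ℂ) * 𝒜.form a b c + ((θ : ℝ) : ℂ) * eulerForm a b c

/-- The Euler-share normalised form `B + γ·B̃_𝒜` (`γ = (1-θ)/θ`). -/
def eulerShareForm (𝒜 : AveragingDatum) (γ : ℝ) : L2C → L2C → L2C → ℂ :=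
  fun a b c => eulerForm a b c + ((γ : ℝ) : ℂ) * 𝒜.form a b c

/-- Bounded-temperature witness predicate for a general form `T` at ceiling `M`, datum `u₀`:
Schwartz divergence-free datum, `H¹⁰_df`-mild solution on `[0,S)`, Type-I bound `M/√(S-t)`,
no mild extension past `S` (verbatim body of the crux's set). -/
def IsWitnessFor (T : L2C → L2C → L2C → ℂ) (M : ℝ) (u₀ : SchwartzMap ℝ³ ℝ³) : Prop :=
  VectorCalculus.IsDivFree ⇑u₀ ∧ ∃ S : ℝ, 0 < S ∧ ∃ u : ℝ → L2C,
    IsMildSolutionFor T (schwartzL2 u₀) (Ico 0 S) u ∧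
    (∀ t ∈ Ico 0 S, eLpNorm (u t) ⊤ volume ≤ ENNReal.ofReal (M / Real.sqrt (S - t))) ∧
    ¬ ∃ S' : ℝ, S < S' ∧ ∃ v : ℝ → L2C,
      IsMildSolutionFor T (schwartzL2 u₀) (Ico 0 S') v ∧ ∀ t ∈ Ico 0 S, v t = u t

/-- Type-I-free blow-up witness predicate for a form `T` from the Schwartz datum `u₀`: divergence
free, `H¹⁰_df`-mild solution on `[0,S)`, no mild extension past `S` (no temperature bound). -/
def IsBlowupWitnessFor (T : L2C → L2C → L2C → ℂ) (u₀ : SchwartzMap ℝ³ ℝ³) : Prop :=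
  VectorCalculus.IsDivFree ⇑u₀ ∧ ∃ S : ℝ, 0 < S ∧ ∃ u : ℝ → L2C,
    IsMildSolutionFor T (schwartzL2 u₀) (Ico 0 S) u ∧
    ¬ ∃ S' : ℝ, S < S' ∧ ∃ v : ℝ → L2C,
      IsMildSolutionFor T (schwartzL2 u₀) (Ico 0 S') v ∧ ∀ t ∈ Ico 0 S, v t = u t

/-- A bounded-temperature witness is in particular a blow-up witness. -/
theorem IsWitnessFor.isBlowupWitnessFor {T : L2C → L2C → L2C → ℂ} {M : ℝ} {u₀ : SchwartzMap ℝ³ ℝ³}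
    (h : IsWitnessFor T M u₀) : IsBlowupWitnessFor T u₀ := by
  obtain ⟨hdiv, S, hS, u, hmild, -, hno⟩ := h
  exact ⟨hdiv, S, hS, u, hmild, hno⟩

/-- The bounded-temperature blow-up set of `𝒜` at ceiling `M` (the crux asserts it is closed). -/
def btSet (𝒜 : AveragingDatum) (M : ℝ) : Set ℝ :=
  {θ : ℝ | θ ∈ Icc (0 : ℝ) 1 ∧ ∃ u₀ : SchwartzMap ℝ³ ℝ³, IsWitnessFor (segForm 𝒜 θ) M u₀}

/-- The crux read through `btSet` (definitional). -/
theorem boundedTemperatureClosed_iff :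
    BoundedTemperatureClosed ↔
      ∀ 𝒜 : AveragingDatum, 𝒜.IsSymmetric → 𝒜.HasCancellation → ∀ M : ℝ, IsClosed (btSet 𝒜 M) :=
  Iff.rfl

/-! ### Card `euler-share-uloc-endpoint` -/

/-- **First lemma (Euler-share normalisation).** If `u` is a mild solution for the segment form
`T_θ` with `θ > 0`, then `w = θ•u` is a mild solution for `B + γB̃`, `γ = (1-θ)/θ`, from the datum
`θ•u₀` (pure algebra: `T_θ(u,u) = θ·(B + γB̃)(u,u)` and both forms are bilinear in the first two
slots; the Type-I constant becomes `θM ≤ M`). -/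
def EulerShareNormalisation : Prop :=
  ∀ (𝒜 : AveragingDatum) (θ : ℝ), 0 < θ → ∀ (u₀ : L2C) (I : Set ℝ) (u : ℝ → L2C),
    IsMildSolutionFor (segForm 𝒜 θ) u₀ I u →
      IsMildSolutionFor (eulerShareForm 𝒜 ((1 - θ) / θ)) ((θ : ℂ) • u₀) I (fun t => (θ : ℂ) • u t)

/-- **The endpoint limit object** at ceiling `M`: a suitable weak (local-energy) solution `(v, π)`
of the TRUE Navier–Stokes equations on the slab `(0,1) × ℝ³`, attaining a BOUNDED (possibly
non-decaying) datum `v₀`, `|v₀| ≤ M`, in `L²_loc`, obeying the Type-I profile bound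
`|v(t,x)| ≤ M/√(1-t)`, with a local Type-I singular point (Albritton–Barker) at `(1, x)`. -/
def EndpointLimitObject (M : ℝ) : Prop :=
  ∃ (v₀ : ℝ³ → ℝ³) (v : ℝ → ℝ³ → ℝ³) (π : ℝ → ℝ³ → ℝ) (x : ℝ³) (r₀ : ℝ),
    (∀ y, ‖v₀ y‖ ≤ M) ∧
    IsSuitableWeakSolutionOn (slab ℝ³ (Ioo 0 1) isOpen_Ioo) 1 0 v π ∧
    (∀ K : Set ℝ³, IsCompact K →
      Tendsto (fun t => ∫⁻ y in K, ‖v t y - v₀ y‖ₑ ^ 2) (𝓝[>] 0) (𝓝 0)) ∧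
    (∀ t ∈ Ioo (0 : ℝ) 1, ∀ y, ‖v t y‖ ≤ M / Real.sqrt (1 - t)) ∧
    IsLocalTypeISingularPoint r₀ ((1 : ℝ), x) v π

/-- **Endpoint compactness (the compactness half of the card).** Bounded-temperature witnesses at
parameters `θₙ → 1`, `θₙ < 1`, produce — after Euler-share normalisation, translation of a
singular point, parabolic rescaling of the blow-up time to `1`, and a local-energy limit — an
`EndpointLimitObject M`.  Uses `HasCancellation` (energy identity along the segment). -/
def EndpointCompactness : Prop :=
  ∀ (𝒜 : AveragingDatum), 𝒜.HasCancellation → ∀ (M : ℝ) (θ : ℕ → ℝ),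
    (∀ n, θ n < 1) → Tendsto θ atTop (𝓝 1) → (∀ n, θ n ∈ btSet 𝒜 M) → EndpointLimitObject M

/-- **Type-I decay stripping (the isolated hard half).** From a bounded-datum local-energy
Navier–Stokes solution with a Type-I singular point, manufacture a Schwartz-datum `H¹⁰_df`-mild
solution of the true Navier–Stokes form with temperature `≤ M` and no mild extension. -/
def TypeIDecayStripping : Prop :=
  ∀ M : ℝ, EndpointLimitObject M → ∃ u₀ : SchwartzMap ℝ³ ℝ³, IsBlowupWitnessFor eulerForm u₀

/-- The sharper, temperature-keeping stripping (would give `1 ∈ btSet` itself; for scaled-Euler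
data it contains the attainment of the infimal Navier–Stokes Type-I temperature — Disproof (b) —
so the card does NOT claim it). -/
def TypeIDecayStrippingSharp : Prop :=
  ∀ M : ℝ, EndpointLimitObject M → ∃ u₀ : SchwartzMap ℝ³ ℝ³, IsWitnessFor eulerForm M u₀

/-- The endpoint-only, Type-I-free LINK the route's `closes` actually consumes (the refuters'
`BoundedTemperatureClosedAtOne` shape): accumulation of bounded-temperature blow-up parameters at
`θ = 1` forces a Schwartz-datum mild blow-up of the true Navier–Stokes form. -/
def AtOneLink : Prop :=
  ∀ (𝒜 : AveragingDatum), 𝒜.IsSymmetric → 𝒜.HasCancellation → ∀ (M : ℝ) (θ : ℕ → ℝ),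
    (∀ n, θ n < 1) → Tendsto θ atTop (𝓝 1) → (∀ n, θ n ∈ btSet 𝒜 M) →
      ∃ u₀ : SchwartzMap ℝ³ ℝ³, IsBlowupWitnessFor eulerForm u₀

/-- The temperature-keeping endpoint closedness (`1 ∈ btSet`), implied by the crux. -/
def AtOneClosed : Prop :=
  ∀ (𝒜 : AveragingDatum), 𝒜.IsSymmetric → 𝒜.HasCancellation → ∀ (M : ℝ) (θ : ℕ → ℝ),
    (∀ n, θ n < 1) → Tendsto θ atTop (𝓝 1) → (∀ n, θ n ∈ btSet 𝒜 M) → (1 : ℝ) ∈ btSet 𝒜 M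

/-- The crux implies the temperature-keeping endpoint closedness (closed sets contain limits). -/
theorem atOneClosed_of_crux (h : BoundedTemperatureClosed) : AtOneClosed := by
  intro 𝒜 hsym hcanc M θ _ hθ hmem
  exact (h 𝒜 hsym hcanc M).mem_of_tendsto hθ (Eventually.of_forall hmem)

/-- … which implies the Type-I-free link. -/
theorem atOneLink_of_atOneClosed (h : AtOneClosed) : AtOneLink := by
  intro 𝒜 hsym hcanc M θ hlt hθ hmem
  obtain ⟨-, u₀, hu₀⟩ := h 𝒜 hsym hcanc M θ hlt hθ hmem
  refine ⟨u₀, ?_⟩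
  have h1 : segForm 𝒜 1 = eulerForm := by
    funext a b c
    simp [segForm]
  rw [← h1]
  exact hu₀.isBlowupWitnessFor

/-- At `θ = 1` the segment form is the Euler form. -/
theorem segForm_one (𝒜 : AveragingDatum) : segForm 𝒜 1 = eulerForm := by
  funext a b c
  simp [segForm]

/-- **Glue.** Compactness + stripping give the endpoint link. -/
theorem atOneLink_of_compactness_of_stripping (hC : EndpointCompactness) (hS : TypeIDecayStripping) :
    AtOneLink := by
  intro 𝒜 _ hcanc M θ hlt hθ hmem
  exact hS M (hC 𝒜 hcanc M θ hlt hθ hmem)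

/-- … and the sharp stripping would give the temperature-keeping endpoint closedness. -/
theorem atOneClosed_of_compactness_of_strippingSharp (hC : EndpointCompactness)
    (hS : TypeIDecayStrippingSharp) : AtOneClosed := by
  intro 𝒜 _ hcanc M θ hlt hθ hmem
  obtain ⟨u₀, hu₀⟩ := hS M (hC 𝒜 hcanc M θ hlt hθ hmem)
  refine ⟨⟨zero_le_one, le_rfl⟩, u₀, ?_⟩
  rw [segForm_one]
  exact hu₀

/-- **The route still closes through the Type-I-free link** (the refuters' `closes'`, re-proved
here against this file's names): Door + AtOneLink + the proved support `MildBlowupClassical`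
refute Clay (A). -/
theorem not_navierStokesRegularity_of_atOneLink (hLink : AtOneLink) (hDoor : EulerProximatePump)
    (hBridge : MildBlowupClassical) : ¬ _root_.NavierStokesRegularity := by
  obtain ⟨𝒜, hsym, hcanc, M, hM⟩ := hDoor
  have hδ : ∀ n : ℕ, (0 : ℝ) < 1 / ((n : ℝ) + 1) := fun n => by positivity
  choose θ hθ using fun n : ℕ => hM (1 / ((n : ℝ) + 1)) (hδ n)
  have hlt : ∀ n, θ n < 1 := fun n => (hθ n).2.1
  have hmem : ∀ n, θ n ∈ btSet 𝒜 M := fun n =>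
    ⟨⟨(hθ n).2.2.1, (hθ n).2.1.le⟩, (hθ n).2.2.2⟩
  have hθ1 : Tendsto θ atTop (𝓝 1) := by
    have h0 : Tendsto (fun n : ℕ => 1 - 1 / ((n : ℝ) + 1)) atTop (𝓝 (1 - 0)) :=
      tendsto_const_nhds.sub tendsto_one_div_add_atTop_nhds_zero_nat
    rw [sub_zero] at h0
    refine tendsto_of_tendsto_of_tendsto_of_le_of_le h0 tendsto_const_nhds
      (fun n => (hθ n).1.le) (fun n => (hlt n).le)
  obtain ⟨u₀, hdiv, S, hS, u, hmild, hnoext⟩ := hLink 𝒜 hsym hcanc M θ hlt hθ1 hmem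
  obtain ⟨T, hT, w, p, hmax, hLH, hdec⟩ := hBridge u₀ hdiv S hS u hmild hnoext
  exact Literature.NS.blowup_assembly ⟨⟨1, one_pos, T, hT, w, p, hmax, hLH, hdec⟩,
    Summit.NavierStokesRegularity.NavierStokesRegularity.Theorems.blowup_clay_uniqueness⟩

/-- **By-product for the route.** The Door alone (crux `EulerProximatePump`) already yields a
local Type-I singularity of the true Navier–Stokes equations (hence, by the in-tree named fact
`AlbrittonBarkerTypeICharacterization`, a non-trivial mild bounded ancient solution with `𝐈 < ∞`,
i.e. the failure of the KNSS Liouville conjecture) — given `EndpointCompactness`. -/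
theorem door_localTypeI (hC : EndpointCompactness) (hDoor : EulerProximatePump) :
    LocalTypeISingularityExists := by
  obtain ⟨𝒜, _, hcanc, M, hM⟩ := hDoor
  -- choose θₙ with 1 - 1/(n+1) < θₙ < 1 in the blow-up set
  have hδ : ∀ n : ℕ, (0 : ℝ) < 1 / ((n : ℝ) + 1) := fun n => by positivity
  choose θ hθ using fun n : ℕ => hM (1 / ((n : ℝ) + 1)) (hδ n)
  have hlt : ∀ n, θ n < 1 := fun n => (hθ n).2.1
  have hmem : ∀ n, θ n ∈ btSet 𝒜 M := fun n =>
    ⟨⟨(hθ n).2.2.1, (hθ n).2.1.le⟩, (hθ n).2.2.2⟩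
  have hθ1 : Tendsto θ atTop (𝓝 1) := by
    have h0 : Tendsto (fun n : ℕ => 1 - 1 / ((n : ℝ) + 1)) atTop (𝓝 (1 - 0)) :=
      tendsto_const_nhds.sub tendsto_one_div_add_atTop_nhds_zero_nat
    rw [sub_zero] at h0
    refine tendsto_of_tendsto_of_tendsto_of_le_of_le h0 tendsto_const_nhds
      (fun n => (hθ n).1.le) (fun n => (hlt n).le)
  obtain ⟨v₀, v, π, x, r₀, -, -, -, -, hsing⟩ := hC 𝒜 hcanc M θ hlt hθ1 hmem
  exact ⟨r₀, ((1 : ℝ), x), v, π, hsing⟩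

/-! ### Card `closed-relation-taming` -/

/-- **First lemma (the blow-up relation is closed).** Joint sequential closedness of
`R_M = {(u₀, θ) : u₀ is a bounded-temperature witness at θ}` in `𝓢_σ × [0,1]` (Schwartz topology
on data): uniform-in-`θ` `H¹⁰_df` local well-posedness with continuous dependence for the segment
forms, energy identity (`HasCancellation`) ⇒ blow-up times bounded above, lower semicontinuity of
the maximal time, upper bound of the temperature passing to the limit. -/
def ClosedRelation : Prop :=
  ∀ (𝒜 : AveragingDatum), 𝒜.HasCancellation → ∀ (M : ℝ) (θ : ℕ → ℝ) (θ' : ℝ)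
    (u₀ : ℕ → SchwartzMap ℝ³ ℝ³) (u₀' : SchwartzMap ℝ³ ℝ³),
    Tendsto θ atTop (𝓝 θ') → Tendsto u₀ atTop (𝓝 u₀') →
    (∀ n, θ n ∈ Icc (0 : ℝ) 1 ∧ IsWitnessFor (segForm 𝒜 (θ n)) M (u₀ n)) →
      θ' ∈ Icc (0 : ℝ) 1 ∧ IsWitnessFor (segForm 𝒜 θ') M u₀'

/-- **Taming (the isolated hard half).** Witness data can be chosen in one compact subset of the
Schwartz space (Fréchet–Montel: bounded in every seminorm suffices). -/
def Taming : Prop :=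
  ∀ (𝒜 : AveragingDatum), 𝒜.HasCancellation → ∀ M : ℝ,
    ∃ K : Set (SchwartzMap ℝ³ ℝ³), IsCompact K ∧
      ∀ θ ∈ btSet 𝒜 M, ∃ u₀ ∈ K, IsWitnessFor (segForm 𝒜 θ) M u₀

/-- **Sequential taming** (weaker than `Taming`, still sufficient): along any convergent sequence of
blow-up parameters one can re-choose witnesses whose data converge in the Schwartz topology along a
subsequence ("no loss of compactness of ignition data"). -/
def SeqTaming : Prop :=
  ∀ (𝒜 : AveragingDatum), 𝒜.HasCancellation → ∀ (M : ℝ) (θ : ℕ → ℝ) (θ' : ℝ),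
    Tendsto θ atTop (𝓝 θ') → (∀ n, θ n ∈ btSet 𝒜 M) →
      ∃ (φ : ℕ → ℕ) (u₀ : ℕ → SchwartzMap ℝ³ ℝ³) (u₀' : SchwartzMap ℝ³ ℝ³),
        StrictMono φ ∧ Tendsto u₀ atTop (𝓝 u₀') ∧
        ∀ k, IsWitnessFor (segForm 𝒜 (θ (φ k))) M (u₀ k)

/-- **Glue (sequential form).** `ClosedRelation` + `SeqTaming` ⇒ the crux. -/
theorem boundedTemperatureClosed_of_closedRelation_of_seqTaming (hR : ClosedRelation)
    (hT : SeqTaming) : BoundedTemperatureClosed := by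
  rw [boundedTemperatureClosed_iff]
  intro 𝒜 _ hcanc M
  refine IsSeqClosed.isClosed fun θ θ' hmem hθ => ?_
  obtain ⟨φ, u₀, u₀', hφ, hlim, hw⟩ := hT 𝒜 hcanc M θ θ' hθ hmem
  have h := hR 𝒜 hcanc M (θ ∘ φ) θ' u₀ u₀' (hθ.comp hφ.tendsto_atTop) hlim
    (fun k => ⟨(hmem (φ k)).1, hw k⟩)
  exact ⟨h.1, u₀', h.2⟩

/-- **The provable tame core**: closedness of the set of parameters admitting witnesses with data
in a fixed compact family. -/
def TameClosed : Prop :=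
  ∀ (𝒜 : AveragingDatum), 𝒜.HasCancellation → ∀ (M : ℝ) (K : Set (SchwartzMap ℝ³ ℝ³)),
    IsCompact K → IsClosed {θ : ℝ | θ ∈ Icc (0 : ℝ) 1 ∧ ∃ u₀ ∈ K, IsWitnessFor (segForm 𝒜 θ) M u₀}

/-- `ClosedRelation` gives the tame core (sequential closedness + compactness of `K`). -/
theorem tameClosed_of_closedRelation (hR : ClosedRelation) : TameClosed := by
  intro 𝒜 hcanc M K hK
  refine IsSeqClosed.isClosed fun θ θ' hmem hθ => ?_
  choose u₀ hu₀K hu₀ using fun n => (hmem n).2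
  obtain ⟨u₀', hu₀'K, φ, hφ, hlim⟩ := hK.tendsto_subseq hu₀K
  have h := hR 𝒜 hcanc M (θ ∘ φ) θ' (u₀ ∘ φ) u₀' (hθ.comp hφ.tendsto_atTop) hlim
    (fun n => ⟨(hmem (φ n)).1, hu₀ (φ n)⟩)
  exact ⟨h.1, u₀', hu₀'K, h.2⟩

/-- **Glue.** `ClosedRelation` + `Taming` ⇒ the crux. -/
theorem boundedTemperatureClosed_of_closedRelation_of_taming (hR : ClosedRelation)
    (hT : Taming) : BoundedTemperatureClosed := by
  rw [boundedTemperatureClosed_iff]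
  intro 𝒜 _ hcanc M
  obtain ⟨K, hK, hKw⟩ := hT 𝒜 hcanc M
  have hcl := tameClosed_of_closedRelation hR 𝒜 hcanc M K hK
  have heq : btSet 𝒜 M = {θ : ℝ | θ ∈ Icc (0 : ℝ) 1 ∧ ∃ u₀ ∈ K, IsWitnessFor (segForm 𝒜 θ) M u₀} := by
    ext θ
    constructor
    · intro h
      obtain ⟨u₀, hu₀K, hu₀⟩ := hKw θ h
      exact ⟨h.1, u₀, hu₀K, hu₀⟩
    · rintro ⟨h1, u₀, -, hu₀⟩
      exact ⟨h1, u₀, hu₀⟩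
  rw [heq]
  exact hcl

end Summit.NavierStokesRegularity.NavierStokesRegularity.Cruxes.BoundedTemperatureClosed.Ideator1
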